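import Mathlib
import Literature.Analysis.SpecialFunctions.FactorialRootLimit
import HarnessLib

/-!
# The limit bookkeeping of the Calegari–Dimitrov–Tang dimension bound (CDT §2.2, end)

`Literature/Analysis/Asymptotics/HolonomyBoundLimits.lean`. Everything here is PROVED (no
definition, no named fact). We isolate the two passages to the limit that conclude the proof of
Lemma 2.0.4 (the "meromorphic form" of the arithmetic holonomy bound) in F. Calegari, V. Dimitrov,
Y. Tang, *The unbounded denominators conjecture* (J. Amer. Math. Soc. **38** (2025), 627–702;
arXiv:2109.09040), §2.2:

1. `le_of_forall_linear_bound` — "as `α → ∞` with respect to the other parameters": if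
   `α L ≤ D(α) Λ + κ C α + E(α)` for all large `α`, where `D(α)/α → δ` and `E(α)/α → 0`
   (the `o(α)` terms), then `L ≤ δ Λ + κ C`.
2. `le_exp_mul_div_of_forall_dim_bound` — "This proves the dimension bound
   `m ≤ inf_{d, 0 < κ < L/|C|} { (d/(d!)^{1/d}) (1 + 1/κ)^{1/d} Λ / (L − κ C) }` …
   Lemma 2.0.4 now follows by firstly letting `d → ∞` and then `κ → 0`, and observing that in
   that limit `(d/(d!)^{1/d}) (1 + 1/κ)^{1/d} → e` while `κ C → 0`": if `m` is bounded as
   displayed for all `d ≥ 1` and all small `κ > 0`, then `m ≤ e Λ / L`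
   (the Stirling limit is `Literature.Analysis.SpecialFunctions.tendsto_div_factorial_rpow_mul_rpow`).
3. `le_of_forall_linear_bound_nat` — item 1 along `α ∈ ℕ` (the parameter `α` of Lemma 2.1.1,
   "vanishing to order at least `α`", is a natural number).
4. `tendsto_linear_div_natCast`, `tendsto_log_linear_div_natCast` — the elementary limits
   `(aα + b)/α → a`, `log(aα + b)/α → 0` identifying the `o(α)` terms.
5. `exists_degree_param` — the degree parameter choice of Lemma 2.1.1 (1): `D ≥ 1` with
   `(1 + 1/κ) C(α+d−1, d) ≤ (mD)ᵈ` (Dirichlet exponent `≤ κ` in Siegel's lemma for the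
   `C(α+d−1, d)` equations in `(mD)ᵈ` unknowns) and `D ≤ (1+1/κ)^{1/d} (d!)^{−1/d} (α+d)/m + 1`.
6. `dim_bound_of_linear_bound` — the algebra from `L ≤ d δ Λ + κC` to the displayed dimension
   bound (the hypothesis of item 2).

## References

* [CalegariDimitrovTang2025] F. Calegari, V. Dimitrov, Y. Tang, The unbounded denominators
  conjecture, J. Amer. Math. Soc. 38 (2025), no. 3, 627–702, §2.2 (proof of Lemma 2.0.4, last
  three displays); arXiv:2109.09040.
-/

noncomputable section

open Real Filter Topology Nat

namespace Literature.Analysis.Asymptotics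

/-- **Dividing by `α → ∞`.** If `α L ≤ D(α) Λ + K α + E(α)` for all large real `α`, with
`D(α)/α → δ` and `E(α)/α → 0`, then `L ≤ δ Λ + K`. (CDT §2.2: the asymptotic bound
"`α log|φ'(0)| ≤ (d/(d!)^{1/d})(1 + 1/κ)^{1/d} (α/m) max{…} + κ C α + o(α)` as `α → ∞`"
yields the dimension bound.) [cite: CalegariDimitrovTang2025, §2.2] -/
theorem le_of_forall_linear_bound {L Λ K δ : ℝ} {D E : ℝ → ℝ}
    (hD : Tendsto (fun α ↦ D α / α) atTop (𝓝 δ)) (hE : Tendsto (fun α ↦ E α / α) atTop (𝓝 0))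
    (h : ∀ᶠ α in atTop, α * L ≤ D α * Λ + K * α + E α) : L ≤ δ * Λ + K := by
  have hlim : Tendsto (fun α ↦ D α / α * Λ + K + E α / α) atTop (𝓝 (δ * Λ + K + 0)) :=
    ((hD.mul_const Λ).add_const K).add hE
  rw [add_zero] at hlim
  refine ge_of_tendsto hlim ?_
  filter_upwards [h, eventually_gt_atTop 0] with α hα hα0
  have : L ≤ (D α * Λ + K * α + E α) / α := by rwa [le_div_iff₀ hα0, mul_comm]
  calc L ≤ (D α * Λ + K * α + E α) / α := this
    _ = D α / α * Λ + K + E α / α := by field_simp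

/-- **Letting `d → ∞` and then `κ → 0`.** Suppose `L > 0` and that a real number `m`
satisfies, for every `d ≥ 1` and every `κ > 0` with `κ C < L`,
`m ≤ (d/(d!)^{1/d}) (1 + 1/κ)^{1/d} Λ / (L − κ C)`. Then `m ≤ e Λ / L`.
(CDT §2.2, conclusion of the proof of Lemma 2.0.4; the limit `(d/(d!)^{1/d})(1+1/κ)^{1/d} → e`
is Stirling's.) [cite: CalegariDimitrovTang2025, §2.2] -/
theorem le_exp_mul_div_of_forall_dim_bound {m L Λ C : ℝ} (hL : 0 < L)
    (h : ∀ d : ℕ, 1 ≤ d → ∀ κ : ℝ, 0 < κ → κ * C < L →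
      m ≤ (d : ℝ) / (d ! : ℝ) ^ ((d : ℝ)⁻¹) * (1 + κ⁻¹) ^ ((d : ℝ)⁻¹) * Λ / (L - κ * C)) :
    m ≤ Real.exp 1 * Λ / L := by
  -- Step 1: for each admissible `κ`, let `d → ∞`
  have hκ : ∀ κ : ℝ, 0 < κ → κ * C < L → m ≤ Real.exp 1 * Λ / (L - κ * C) := by
    intro κ hκ0 hκC
    have hc : 0 < 1 + κ⁻¹ := by positivity
    have hlim := (Literature.Analysis.SpecialFunctions.tendsto_div_factorial_rpow_mul_rpow hc).mul_const
      (Λ / (L - κ * C))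
    refine ge_of_tendsto (by simpa [mul_div_assoc] using hlim) ?_
    filter_upwards [eventually_ge_atTop 1] with d hd
    have := h d hd κ hκ0 hκC
    simpa [mul_div_assoc] using this
  -- Step 2: let `κ → 0⁺`
  have hcont : Tendsto (fun κ : ℝ ↦ Real.exp 1 * Λ / (L - κ * C)) (𝓝[>] 0)
      (𝓝 (Real.exp 1 * Λ / (L - 0 * C))) := by
    refine ((tendsto_const_nhds.div (tendsto_const_nhds.sub
      ((continuous_id.tendsto 0).mul_const C)) ?_).mono_left nhdsWithin_le_nhds)
    simp [hL.ne']
  rw [zero_mul, sub_zero] at hcont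
  refine ge_of_tendsto hcont ?_
  -- eventually, for `κ → 0⁺`, `κ C < L`
  have hev : ∀ᶠ κ : ℝ in 𝓝[>] 0, κ * C < L := by
    have : Tendsto (fun κ : ℝ ↦ κ * C) (𝓝[>] 0) (𝓝 (0 * C)) :=
      ((continuous_id.tendsto 0).mul_const C).mono_left nhdsWithin_le_nhds
    rw [zero_mul] at this
    exact this.eventually (gt_mem_nhds hL)
  filter_upwards [hev, self_mem_nhdsWithin] with κ hκC hκ0
  exact hκ κ hκ0 hκC

/-! ### 3. The `α → ∞` limit along the natural numbers

The auxiliary parameter `α` of CDT's Lemma 2.1.1 ("vanishing to order at least `α`") is a natural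
number, so the assembly of Lemma 2.0.4 needs `le_of_forall_linear_bound` along `ℕ`. -/

/-- **Dividing by `α → ∞` (`α ∈ ℕ`).** If `α L ≤ D(α) Λ + K α + E(α)` for all large natural `α`,
with `D(α)/α → δ` and `E(α)/α → 0`, then `L ≤ δ Λ + K`. [cite: CalegariDimitrovTang2025, §2.2] -/
theorem le_of_forall_linear_bound_nat {L Λ K δ : ℝ} {D E : ℕ → ℝ}
    (hD : Tendsto (fun α : ℕ ↦ D α / α) atTop (𝓝 δ))
    (hE : Tendsto (fun α : ℕ ↦ E α / α) atTop (𝓝 0))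
    (h : ∀ᶠ α : ℕ in atTop, (α : ℝ) * L ≤ D α * Λ + K * α + E α) : L ≤ δ * Λ + K := by
  have hlim : Tendsto (fun α : ℕ ↦ D α / α * Λ + K + E α / α) atTop (𝓝 (δ * Λ + K + 0)) :=
    ((hD.mul_const Λ).add_const K).add hE
  rw [add_zero] at hlim
  refine ge_of_tendsto hlim ?_
  filter_upwards [h, eventually_gt_atTop 0] with α hα hα0
  have hα0' : (0 : ℝ) < α := by exact_mod_cast hα0
  have : L ≤ (D α * Λ + K * α + E α) / α := by rwa [le_div_iff₀ hα0', mul_comm]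
  calc L ≤ (D α * Λ + K * α + E α) / α := this
    _ = D α / α * Λ + K + E α / α := by field_simp

/-! ### 4. Elementary limits for the `o(α)` terms -/

/-- `(a α + b)/α → a` along `ℕ`. [folklore] -/
theorem tendsto_linear_div_natCast (a b : ℝ) :
    Tendsto (fun α : ℕ ↦ (a * α + b) / α) atTop (𝓝 a) := by
  have h : Tendsto (fun α : ℕ ↦ a + b / (α : ℝ)) atTop (𝓝 (a + 0)) :=
    tendsto_const_nhds.add (tendsto_const_div_atTop_nhds_zero_nat b)
  rw [add_zero] at h
  refine h.congr' ?_
  filter_upwards [eventually_gt_atTop 0] with α hα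
  have hα' : (α : ℝ) ≠ 0 := by exact_mod_cast hα.ne'
  field_simp

/-- `log(a α + b)/α → 0` along `ℕ`, for `a ≥ 0` (the `o(α)` terms `log (mD)`, `log α` of the
Siegel-lemma height bound). [folklore] -/
theorem tendsto_log_linear_div_natCast {a : ℝ} (ha : 0 ≤ a) (b : ℝ) :
    Tendsto (fun α : ℕ ↦ Real.log (a * α + b) / α) atTop (𝓝 0) := by
  rcases ha.eq_or_lt with h0 | ha'
  · subst h0
    simp only [zero_mul, zero_add]
    exact tendsto_const_div_atTop_nhds_zero_nat _
  · have hlin : Tendsto (fun x : ℝ ↦ a * x + b) atTop atTop :=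
      tendsto_atTop_add_const_right _ b (Tendsto.const_mul_atTop ha' tendsto_id)
    have h1 : (fun x : ℝ ↦ Real.log (a * x + b)) =o[atTop] fun x ↦ a * x + b :=
      Real.isLittleO_log_id_atTop.comp_tendsto hlin
    have h2 : (fun x : ℝ ↦ a * x + b) =O[atTop] fun x ↦ x :=
      (Asymptotics.isBigO_const_mul_self a id atTop).add
        (Asymptotics.isLittleO_const_id_atTop b).isBigO
    have h3 := (h1.trans_isBigO h2).tendsto_div_nhds_zero
    exact h3.comp tendsto_natCast_atTop_atTop

/-! ### 5. The degree parameter of Lemma 2.1.1 -/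

/-- **The degree parameter choice** of CDT's Lemma 2.1.1: "We … solve `binom(α+d, d) ∼ αᵈ/d!`
linear equations in the `(mD)ᵈ` free parameters", with "the degree parameter choice
`D ∼ (1/(m (d!)^{1/d}))(1 + 1/κ)^{1/d} α`, that brings in a Dirichlet exponent `∼ κ`", and
conclusion (1) "`D ≤ (1/(d!)^{1/d}) (1/m) (1 + 1/κ)^{1/d} α + o(α)`". Precisely: for `m, d, α ≥ 1`
and `κ > 0` there is `D ≥ 1` with `(1 + 1/κ) · C(α+d−1, d) ≤ (mD)ᵈ` — `C(α+d−1, d)` being the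
number of monomials of degree `< α` in `d` variables, so that Siegel's lemma applies with
Dirichlet exponent `≤ κ` — and `D ≤ (1 + 1/κ)^{1/d} (d!)^{−1/d} (α + d)/m + 1`.
[cite: CalegariDimitrovTang2025, Lemma 2.1.1 (1) and its proof] -/
theorem exists_degree_param {m d α : ℕ} (hm : 0 < m) (hd : 0 < d) (hα : 0 < α) {κ : ℝ}
    (hκ : 0 < κ) :
    ∃ D : ℕ, 0 < D ∧
      (1 + κ⁻¹) * ((α + d - 1).choose d : ℝ) ≤ ((m * D : ℕ) : ℝ) ^ d ∧
      (D : ℝ) ≤ (1 + κ⁻¹) ^ (d : ℝ)⁻¹ / ((d ! : ℝ) ^ (d : ℝ)⁻¹ * m) * (α + d) + 1 := by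
  set Cα : ℝ := ((α + d - 1).choose d : ℝ) with hC
  have hCpos : 0 < Cα := by
    rw [hC]
    exact_mod_cast Nat.choose_pos (by omega)
  have hk0 : 0 < 1 + κ⁻¹ := by positivity
  have hm' : (0 : ℝ) < m := by exact_mod_cast hm
  have hd0 : d ≠ 0 := hd.ne'
  have hbase : 0 < (1 + κ⁻¹) * Cα := by positivity
  set X : ℝ := ((1 + κ⁻¹) * Cα) ^ (d : ℝ)⁻¹ / m with hX
  have hX0 : 0 < X := by rw [hX]; positivity
  refine ⟨⌈X⌉₊, Nat.ceil_pos.mpr hX0, ?_, ?_⟩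
  · -- `(1 + κ⁻¹) Cα = (m X)ᵈ ≤ (m ⌈X⌉)ᵈ`
    have hmX : (m : ℝ) * X = ((1 + κ⁻¹) * Cα) ^ (d : ℝ)⁻¹ := by
      rw [hX]; field_simp
    calc (1 + κ⁻¹) * Cα = (((1 + κ⁻¹) * Cα) ^ (d : ℝ)⁻¹) ^ d :=
          (Real.rpow_inv_natCast_pow hbase.le hd0).symm
      _ = ((m : ℝ) * X) ^ d := by rw [hmX]
      _ ≤ ((m : ℝ) * (⌈X⌉₊ : ℝ)) ^ d := by
          gcongr
          exact Nat.le_ceil X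
      _ = ((m * ⌈X⌉₊ : ℕ) : ℝ) ^ d := by push_cast; ring
  · -- `⌈X⌉ < X + 1` and `X ≤ (1 + κ⁻¹)^{1/d} ((α + d)ᵈ/d!)^{1/d} / m`
    have hceil : (⌈X⌉₊ : ℝ) ≤ X + 1 := (Nat.ceil_lt_add_one hX0.le).le
    refine hceil.trans (add_le_add_left ?_ 1)
    have hchoose : Cα ≤ ((α : ℝ) + d) ^ d / (d ! : ℝ) := by
      have h1 : (((α + d - 1).choose d : ℕ) : ℝ) ≤ (((α + d - 1 : ℕ) : ℝ)) ^ d / (d ! : ℝ) :=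
        Nat.choose_le_pow_div d (α + d - 1)
      rw [hC]
      refine h1.trans ?_
      have hle : ((α + d - 1 : ℕ) : ℝ) ≤ (α : ℝ) + d := by
        have : α + d - 1 ≤ α + d := Nat.sub_le _ _
        exact_mod_cast this
      have hfac : (0 : ℝ) < (d ! : ℝ) := by exact_mod_cast Nat.factorial_pos d
      exact div_le_div_of_nonneg_right (pow_le_pow_left₀ (by positivity) hle d) hfac.le
    have hαd : (0 : ℝ) ≤ (α : ℝ) + d := by positivity
    calc X = (1 + κ⁻¹) ^ (d : ℝ)⁻¹ * Cα ^ (d : ℝ)⁻¹ / m := by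
          rw [hX, Real.mul_rpow hk0.le hCpos.le]
      _ ≤ (1 + κ⁻¹) ^ (d : ℝ)⁻¹ * (((α : ℝ) + d) ^ d / (d ! : ℝ)) ^ (d : ℝ)⁻¹ / m := by
          gcongr
      _ = (1 + κ⁻¹) ^ (d : ℝ)⁻¹ / ((d ! : ℝ) ^ (d : ℝ)⁻¹ * m) * (α + d) := by
          rw [Real.div_rpow (by positivity) (by positivity),
            Real.pow_rpow_inv_natCast hαd hd0]
          have hfr : (0 : ℝ) < (d ! : ℝ) ^ (d : ℝ)⁻¹ := by positivity
          field_simp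

/-! ### 6. From the linear bound to the dimension bound -/

/-- **The dimension bound from the linear bound** (CDT §2.2: "Combining with (2.6) and (2.7), we
get the asymptotic bound `α log|φ'(0)| ≤ (d/(d!)^{1/d})(1 + 1/κ)^{1/d} (α/m) max{…} + κCα + o(α)`
… This proves the dimension bound `m ≤ … (d/(d!)^{1/d})(1 + 1/κ)^{1/d} max{…}/(log|φ'(0)| − κC)`
contingent on the denominator being positive"): if `L ≤ d · ((1+κ⁻¹)^{1/d}/((d!)^{1/d} m)) Λ + κC`
and `κC < L`, then `m ≤ (d/(d!)^{1/d}) (1+κ⁻¹)^{1/d} Λ/(L − κC)` — the hypothesis of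
`le_exp_mul_div_of_forall_dim_bound`. [cite: CalegariDimitrovTang2025, §2.2] -/
theorem dim_bound_of_linear_bound {m d : ℕ} (hm : 0 < m) {L Λ C κ : ℝ} (hκC : κ * C < L)
    (h : L ≤ d * ((1 + κ⁻¹) ^ (d : ℝ)⁻¹ / ((d ! : ℝ) ^ (d : ℝ)⁻¹ * m)) * Λ + κ * C) :
    (m : ℝ) ≤ (d : ℝ) / (d ! : ℝ) ^ ((d : ℝ)⁻¹) * (1 + κ⁻¹) ^ ((d : ℝ)⁻¹) * Λ / (L - κ * C) := by
  have hm' : (0 : ℝ) < m := by exact_mod_cast hm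
  have hpos : 0 < L - κ * C := sub_pos.mpr hκC
  have hfact : (0 : ℝ) < (d ! : ℝ) ^ (d : ℝ)⁻¹ := by positivity
  rw [le_div_iff₀ hpos]
  have h' : L - κ * C ≤ d * ((1 + κ⁻¹) ^ (d : ℝ)⁻¹ / ((d ! : ℝ) ^ (d : ℝ)⁻¹ * m)) * Λ := by
    linarith
  calc (m : ℝ) * (L - κ * C) ≤ m * (d * ((1 + κ⁻¹) ^ (d : ℝ)⁻¹ / ((d ! : ℝ) ^ (d : ℝ)⁻¹ * m)) * Λ) :=
        mul_le_mul_of_nonneg_left h' hm'.le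
    _ = (d : ℝ) / (d ! : ℝ) ^ ((d : ℝ)⁻¹) * (1 + κ⁻¹) ^ ((d : ℝ)⁻¹) * Λ := by
        field_simp

end Literature.Analysis.Asymptotics
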